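import Summits.BirchSwinnertonDyer.BirchSwinnertonDyer.Theorems.CorpuzLei2025_signedMainConjecture_transfer_OPEN
import Summits.BirchSwinnertonDyer.Rank1Residual.Supersingular.SignedMuVanishing
import Summits.BirchSwinnertonDyer.Rank1Residual.X9.HessePartnerTransport
import Summits.BirchSwinnertonDyer.Rank1Residual.X9.ChaDescentRecords
import Literature.NumberTheory.EllipticCurves.Fisher2012.HesseFamilyThreeCongruenceProofs
import Literature.NumberTheory.EllipticCurves.Fisher2012.HesseFamilyThreeReverseProofs
import Literature.NumberTheory.EllipticCurves.Fisher2012.HesseFamilyFiveClosedForms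
import Literature.NumberTheory.EllipticCurves.Fisher2012.HesseFamilyFiveIndClosedForms
import Literature.NumberTheory.EllipticCurves.Rank1Residual.PeriodUnitProofs
import HarnessLib

/-!
# Route `SignedLowerHalves`, crux `KobayashiMainConjectureSmallImage` (item stmt-BirchSwinnertonDyer-19002) —
# the CM-congruence transfer line (L4-CM), part A: the UNIT CASE as a kernel theorem + the first per-pair records
# (`55648b1 @ 3` = the A7 theorem-needed class, `484416do1 @ 5`), cell `bsd-ssimc`, seat `bsd-ssimc-k3-c4` gen 2

HONEST FRAMING: Kobayashi's signed main conjecture at a non-surjective (normaliser-of-non-split-Cartan) image is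
OPEN; nothing here proves it for any class. Everything below is CONDITIONAL on the explicitly labelled OPEN binder
`CorpuzLei2025_signedMainConjecture_transfer_OPEN` (Corpuz–Lei, arXiv:2508.09733, 2025, an UNREFEREED preprint:
the supersingular Greenberg–Vatsal/Emerton–Pollack–Weston transfer), taken as a hypothesis `hCL` and never
asserted, and on PUBLISHED results consumed BY NAME (`hPR` Pollack–Rubin 2004; `h5`/`h3` the period-unit
comparison Greenberg–Vatsal 2000 §3 Rem. 3.4 + Mazur 1978 / Abbes–Ullmo 1996; at `p = 5` Fisher 2012 Thm. 13.2 /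
Fisher 2013 Thm. 5.8 `hF`/`hF'`; at `p = 3` the Hesse facts are PROVED in the tree and nothing is assumed).
Per pair; item 4 stays OPEN; nothing is booked; BSD is not proved by any of this.

## What this file does (our own work, hence `Summits/…/Theorems`)

The tree's class theorem of the line, `kobayashiMainConjecture_of_cmPartner_of_transfer_OPEN` (p422273): for
`E = W` with `p` odd good and `a_p = 0` (ANY image) and a CM partner `E' = W'` (good supersingular at `p`,
`a_p(E') = 0`, `E[p] ≃ E'[p]` `Γ_ℚ`-equivariantly) whose Kobayashi `L^±_p` have unit content (`hμ'`),
`KobayashiMainConjecture W p ε` for every sign, modulo the binder. HERE: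

* §1 `kobayashiMainConjecture_of_cmPartner_of_lvalue_of_transfer_OPEN` — **the unit case**: the hypothesis
  `hμ'` is DISCHARGED in the kernel from ONE rational number, the `L`-VALUE CERTIFICATE `L(E',1)/Ω(E') = q`
  (`q ≠ 0`, `ord_p q = 0`; the shape of `X9.unitCoeff_zero_of_lvalue`): `[0]⁺_{f'}·Ω⁺_{f'} = L(E',1)`
  (`IsNewformOf.entireLFunction_one_eq`), `ord_p(Ω⁺_{f'}/Ω(E')) = 0` (`padicValRat_periodRatio_eq_zero`, from
  `h5`/`h3`), hence `ord_p [0]⁺_{f'} = 0`, hence `SignedMuVanishing W' p`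
  (`signedMuVanishing_of_frobeniusTrace_eq_zero`, Kurihara's unit case), hence `μ(L^ε) = 0 ∧ L^ε ≠ 0`, hence unit
  content (Greenberg–Vatsal (2)): for a rank-`0` CM partner with `p ∤ L(E',1)/Ω(E')` NO `μ`-certificate is needed.
* §2 kernel data of the CM partners `32a2 : y² = x³ − x` (`j = 1728`) and `[0,0,0,0,−195112]` (`j = 0`):
  `Δ ≠ 0`, minimality (Kraus), `#Ẽ'(𝔽_p) = p + 1`, CM by `j ∈ cmJInvariants` — all `decide`d.
* §3 the records: **`55648b1 @ 3`** (the A7 theorem-needed class of TARGET §6.0b; non-surjective `3Nn`) —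
  `E[3] ≃ E'[3]` for `E' = 32a2` is an UNCONDITIONAL kernel theorem: `E` is `ℚ`-isomorphic to the member
  `(λ:μ) = (44:9)` of the DUAL Hesse pencil `X⁻_{E'}(3)` (`threeCongruent_of_dualHesseCertificate_unconditional`,
  the two covariant identities checked by `norm_num` on the tree's closed forms, scaling `u = 1/108`); and
  **`484416do1 @ 5`** (`5Nn`) — `E ≅` the member `(696:1)` of the Hesse pencil `X_{E'}(5)` of
  `E' = [0,0,0,0,−195112]` (`fiveCongruent_of_hesseCertificate`, modulo Fisher 2012 Thm. 13.2 `hF`,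
  `u = 1469903105654784`). Conclusion per pair: `∀ ε, KobayashiMainConjecture W p ε` — the crux's conclusion
  (`∃ ε`) and both signs — MODULO `hCL` and the named published facts, with ONE displayed certificate binder
  `hL'` : `L(E',1)/Ω(E') = 1/8` resp. `= 2` (two engines: PARI kit j250436; PARI-free modular symbols kit j250942).

Certificates: kit j250394 (PARI) + an independent exact re-derivation from Fisher's printed `𝔇` (seat folder
`work/hesse_cert.py`): all 79 pencil points/scalings re-verify; parts B–D consume the other 21 unit-case pairs.
References: [CorpuzLei2025] Thms 1–3; [PollackRubin2004] Thm. (p. 448); [Kobayashi2003] Conj. (p. 2), (3.6);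
[Kurihara2002] Thm. 0.1; [GreenbergVatsal2000] (2), §3 Rem. 3.4; [Fisher2012Hessian] §8, §13, Thm. 13.2;
[MazurTateTeitelbaum1986Invent] §I.8; [SilvermanAEC2009] III §1, VII.1, App. C §11; [Cremona2006] Table 1.
-/

set_option autoImplicit false
set_option linter.dupNamespace false

noncomputable section

open scoped Classical MatrixGroups ModularForm

open CongruenceSubgroup WeierstrassCurve Literature.NumberTheory.EllipticCurves
  Literature.NumberTheory.EllipticCurves.ModularForms
  Literature.NumberTheory.EllipticCurves.Kobayashi2003 ZpExtension
  Literature.NumberTheory.EllipticCurves.GreenbergVatsal2000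
  Literature.NumberTheory.EllipticCurves.Rank1Residual
  Literature.NumberTheory.EllipticCurves.Rank1Residual.Typed
  Literature.NumberTheory.EllipticCurves.Rank1Residual.X11RankOneCertificates
  Literature.NumberTheory.EllipticCurves.Fisher2012
  Summit.BirchSwinnertonDyer.BirchSwinnertonDyer.Rank1Residual.IntModel
  Summit.BirchSwinnertonDyer.BirchSwinnertonDyer.Rank1Residual.X11RankOne
  Summit.BirchSwinnertonDyer.Rank1Residual.X11b
  Summit.BirchSwinnertonDyer.Rank1Residual.X9
  Summit.BirchSwinnertonDyer.Rank1Residual.X1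
  Summit.BirchSwinnertonDyer.Rank1Residual.Supersingular

namespace Summit.BirchSwinnertonDyer.BirchSwinnertonDyer.Theorems

/-! ### §1. The unit case of the CM-congruence transfer: `hμ'` from one `L`-value -/

section UnitCase

variable (W W' : WeierstrassCurve ℚ) [W.IsElliptic] [W.IsGloballyMinimal] [W'.IsElliptic]
  [W'.IsGloballyMinimal] (p : ℕ) [Fact p.Prime]

/-- **Unit content of `L_p^±(E')` from the `L`-value certificate `L(E',1)/Ω(E') = q`, `ord_p q = 0`.** For a
globally minimal `E' = W'`, an odd prime `p` of good reduction with `a_p(E') = 0`, and a rational `q ≠ 0` with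
`L(E',1)/Ω(E') = q` and `ord_p q = 0`: for the newform `f'` of `E'` and every Pollack pair `(L⁺, L⁻)`, Kobayashi's
`L^ε = kobayashiL ε L⁺ L⁻` has unit content for both signs. Proof: `L(E',1) = [0]⁺_{f'}·Ω⁺_{f'}`
(`IsNewformOf.entireLFunction_one_eq`), so `ϖ' := q/[0]⁺_{f'}` satisfies `ϖ'·Ω(E') = Ω⁺_{f'}` and is a `p`-adic
unit (`padicValRat_periodRatio_eq_zero`, from the named period comparisons `h5`/`h3`; `E'[p]` irreducible as
`a_p = 0`); hence `ord_p [0]⁺_{f'} = 0`, Kurihara's unit case `signedMuVanishing_of_frobeniusTrace_eq_zero` gives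
`μ(L^ε) = 0 ∧ L^ε ≠ 0`, i.e. unit content (Greenberg–Vatsal (2)). No `μ`-certificate is needed in this case.
[cite: Kurihara2002, Thm. 0.1] [cite: Kobayashi2003, (3.6) (p. 7)] [cite: GreenbergVatsal2000, p. 2 (2) and §3 Remark 3.4]
[cite: MazurTateTeitelbaum1986Invent, §I.8 (8.6)] -/
theorem hasUnitContent_kobayashiL_of_lvalue (h5 : realPeriodRat_eq_unit_mul_plusPeriod)
    (h3 : realPeriodRat_eq_unit_mul_plusPeriod_three) (hp : p ≠ 2) (hgood' : W'.HasGoodReductionAtPrime p)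
    (hap' : W'.frobeniusTrace p = 0) {q : ℚ} (hq0 : q ≠ 0)
    (hL' : W'.entireLFunction 1 / (W'.realPeriodRat : ℂ) = (q : ℂ)) (hv : padicValRat p q = 0) :
    ∀ [NeZero (W'.conductorNorm ℤ)] (f' : CuspForm (Gamma0 (W'.conductorNorm ℤ)) 2),
      IsNewformOf W' f' → ∀ (Lplus Lminus : IwasawaAlgebra p), IsPollackPair f' p Lplus Lminus →
      ∀ ε : ℤˣ, HasUnitContent (kobayashiL ε Lplus Lminus) := by
  intro _ f' hf' Lplus Lminus hL ε
  have hirr' : W'.HasIrreducibleModPGaloisRep p :=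
    hasIrreducibleModPGaloisRep_of_dvd_frobeniusTrace W' p hp
      (W'.not_dvd_minimalDiscriminantInt_of_hasGoodReductionAtPrime' p hgood') (by rw [hap']; exact dvd_zero _)
  set s : ℚ := ratPlusSymbol f' 0 with hs_def
  have hΩ : W'.realPeriodRat ≠ 0 := W'.realPeriodRat_pos_holds.ne'
  -- `s · Ω⁺_{f'} = q · Ω(E')` in `ℝ`
  have hreal : (s : ℝ) * plusPeriod f' = (q : ℝ) * W'.realPeriodRat := by
    have h1 : (((s : ℝ) * plusPeriod f' : ℝ) : ℂ) = ((q : ℚ) : ℂ) * (W'.realPeriodRat : ℂ) := by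
      rw [← hf'.entireLFunction_one_eq, ← hL', div_mul_cancel₀ _ (Complex.ofReal_ne_zero.mpr hΩ)]
    have h2 : (((s : ℝ) * plusPeriod f' : ℝ) : ℂ) = (((q : ℝ) * W'.realPeriodRat : ℝ) : ℂ) := by
      rw [h1]; push_cast; ring
    exact Complex.ofReal_injective h2
  have hs0 : s ≠ 0 := by
    intro hz
    rw [hz, Rat.cast_zero, zero_mul] at hreal
    exact mul_ne_zero (Rat.cast_ne_zero.mpr hq0) hΩ hreal.symm
  have hsR : (s : ℝ) ≠ 0 := Rat.cast_ne_zero.mpr hs0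
  -- the period ratio `ϖ' = q / s`
  have hϖ : ((q / s : ℚ) : ℝ) * W'.realPeriodRat = plusPeriod f' := by
    rw [Rat.cast_div, div_mul_eq_mul_div, ← hreal]
    field_simp
  have hvϖ : padicValRat p (q / s) = 0 :=
    padicValRat_periodRatio_eq_zero h5 h3 W' p hp hgood' hirr' f' hf' (q / s) hϖ
  have hvs : padicValRat p s = 0 := by
    rw [padicValRat.div hq0 hs0, hv] at hvϖ
    linarith
  have hμ : SignedMuVanishing W' p := signedMuVanishing_of_frobeniusTrace_eq_zero hp hgood' hap' hf' hs0 hvs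
  obtain ⟨hne, hmu⟩ := hμ.kobayashiL_ne_zero_and_mu_eq_zero hap' hf' hL ε
  -- `μ = 0` and `≠ 0` ⟹ unit content (Greenberg–Vatsal (2))
  rw [hasUnitContent_iff_not_C_dvd]
  intro hdvd
  have h1 : 1 ≤ MuLambda.mu (kobayashiL ε Lplus Lminus) :=
    MuLambda.le_mu_of_C_pow_dvd hne (n := 1) (by rwa [pow_one])
  omega

/-- **The CM-congruence transfer, UNIT CASE (class theorem, MODULO the OPEN binder).** `E = W` with `p` odd good
and `a_p = 0` (ANY image); a CM partner `E' = W'` (`W'.HasCM`, good at `p`, `a_p(E') = 0`) congruent to `E` mod `p`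
(`hiso`: a `Γ_ℚ`-equivariant `E[p] ≃ E'[p]`) with the `L`-VALUE CERTIFICATE `L(E',1)/Ω(E') = q`, `q ≠ 0`,
`ord_p q = 0` (displayed binders `hq0`/`hL'`/`hv`). Granted BY NAME Pollack–Rubin 2004 (`hPR`), the period-unit
facts (`h5`, `h3`) and the OPEN binder (`hCL`, Corpuz–Lei 2025, PRE): `KobayashiMainConjecture W p ε` for EVERY
sign. (= the tree's `kobayashiMainConjecture_of_cmPartner_of_transfer_OPEN` with its `hμ'` discharged by
`hasUnitContent_kobayashiL_of_lvalue`.) CONDITIONAL on `hCL`; nothing asserted about any curve.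
[claim: CorpuzLei2025, status: under-review] [cite: PollackRubin2004, Theorem (p. 448) = Thm. 7.3]
[cite: Kurihara2002, Thm. 0.1] [cite: Kobayashi2003, Conjecture (Main Conjecture) (p. 2)] -/
theorem kobayashiMainConjecture_of_cmPartner_of_lvalue_of_transfer_OPEN
    (hCL : CorpuzLei2025_signedMainConjecture_transfer_OPEN)
    (hPR : PollackRubin2004.mainTheorem_signedCharIdeal_eq_of_cm)
    (h5 : realPeriodRat_eq_unit_mul_plusPeriod) (h3 : realPeriodRat_eq_unit_mul_plusPeriod_three)
    (hp : p ≠ 2) (hgood : W.HasGoodReductionAtPrime p) (hap : W.frobeniusTrace p = 0)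
    (hcm' : W'.HasCM) (hgood' : W'.HasGoodReductionAtPrime p) (hap' : W'.frobeniusTrace p = 0)
    (hiso : ∃ e : geomTorsion W (p : ℤ) ≃+ geomTorsion W' (p : ℤ),
      ∀ (σ : Field.absoluteGaloisGroup ℚ) (P : geomTorsion W (p : ℤ)), e (σ • P) = σ • e P)
    {q : ℚ} (hq0 : q ≠ 0) (hL' : W'.entireLFunction 1 / (W'.realPeriodRat : ℂ) = (q : ℂ))
    (hv : padicValRat p q = 0) (ε : ℤˣ) : KobayashiMainConjecture W p ε :=
  kobayashiMainConjecture_of_cmPartner_of_transfer_OPEN W W' p hCL hPR h5 h3 hp hgood hap hcm'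
    ⟨hgood', by rw [hap']; exact dvd_zero _⟩ hap' hiso
    (hasUnitContent_kobayashiL_of_lvalue W' p h5 h3 hp hgood' hap' hq0 hL' hv) ε

/-- `ord_p (a/b) = 0` for naturals `a, b` prime to `p` (decides an `L`-value certificate's valuation). [folklore] -/
theorem padicValRat_natCast_div_natCast_eq_zero (p a b : ℕ) [Fact p.Prime] (ha : ¬ p ∣ a) (hb : ¬ p ∣ b) :
    padicValRat p ((a : ℚ) / b) = 0 := by
  have ha0 : a ≠ 0 := fun h => ha (h ▸ dvd_zero p)
  have hb0 : b ≠ 0 := fun h => hb (h ▸ dvd_zero p)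
  rw [padicValRat.div (Nat.cast_ne_zero.mpr ha0) (Nat.cast_ne_zero.mpr hb0), padicValRat.of_nat,
    padicValRat.of_nat, padicValNat.eq_zero_of_not_dvd ha, padicValNat.eq_zero_of_not_dvd hb]
  simp

end UnitCase

/-! ### §2. Kernel data of the CM partners `32a2 = [0,0,0,−1,0]` (`j = 1728`) and `[0,0,0,0,−195112]` (`j = 0`) -/

/-- `#{Ẽ'(𝔽_3)} = 4` for `32a2 : y² = x³ − x` (`a_3 = 0`: good SUPERSINGULAR; kernel count). [folklore] -/
theorem card_cm32a2_3 :
    Nat.card (((⟨0, 0, 0, -1, 0⟩ : WeierstrassCurve ℤ).map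
      (Int.castRingHom (ZMod 3))).toAffine.Point) = 4 := by
  rw [@WeierstrassCurve.natCard_point_eq_one_add_card (ZMod 3) (@ZMod.instField 3 ⟨by norm_num⟩) _ _ _
    (by decide +kernel), @card_sol_eq_sum_euler (ZMod 3) (@ZMod.instField 3 ⟨by norm_num⟩) _ _
    (by rw [ZMod.ringChar_zmod_n]; decide), ZMod.card]
  decide +kernel

-- `32a2` is elliptic and globally minimal: ALREADY in the tree as
-- `Literature.NumberTheory.EllipticCurves.isElliptic_caseI_example` (BSDSelmerSmithCasesExplicitProofs) and
-- `Summit.….Theorems.tamePinch_isGloballyMinimal_thirtyTwoA2` (TamePinch/Negative/CMQuarticImage); not restated.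

/-- `32a2 : y² = x³ − x` has CM (`j = 48³/64 = 1728 ∈` the thirteen CM values; Silverman App. C §11), for any
globally minimal `A` with this integral model. [cite: SilvermanAEC2009, App. C §11] -/
theorem hasCM_cm32a2 {A : WeierstrassCurve ℚ} [A.IsElliptic] [A.IsGloballyMinimal]
    (hIA : integralModelInt A = ⟨0, 0, 0, -1, 0⟩) : A.HasCM :=
  (hasCM_iff_j_mem_holds A).mpr (by rw [j_eq_of_intModel 0 0 0 (-1) 0 hIA]; decide +kernel)

/-- `#{Ẽ'(𝔽_5)} = 6` for `E' = [0,0,0,0,−195112] : y² = x³ − 195112` (`a_5 = 0`: good SUPERSINGULAR; kernel count). [folklore] -/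
theorem card_cm0m195112_5 :
    Nat.card (((⟨0, 0, 0, 0, -195112⟩ : WeierstrassCurve ℤ).map
      (Int.castRingHom (ZMod 5))).toAffine.Point) = 6 := by
  rw [@WeierstrassCurve.natCard_point_eq_one_add_card (ZMod 5) (@ZMod.instField 5 ⟨by norm_num⟩) _ _ _
    (by decide +kernel), @card_sol_eq_sum_euler (ZMod 5) (@ZMod.instField 5 ⟨by norm_num⟩) _ _
    (by rw [ZMod.ringChar_zmod_n]; decide), ZMod.card]
  decide +kernel

/-- `y² = x³ − 195112` is an elliptic curve (`Δ ≠ 0`, kernel). [folklore] -/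
theorem isElliptic_cm0m195112 : (⟨0, 0, 0, 0, -195112⟩ : WeierstrassCurve ℚ).IsElliptic :=
  isElliptic_of_discOf_ne_zero 0 0 0 0 (-195112) (by decide +kernel)

/-- `y² = x³ − 195112` (`195112 = 2³·29³`) is globally minimal (Kraus' bounded criterion, kernel).
[cite: SilvermanAEC2009, VII.1 Remark 1.1] -/
theorem isGloballyMinimal_cm0m195112 : (⟨0, 0, 0, 0, -195112⟩ : WeierstrassCurve ℚ).IsGloballyMinimal :=
  isGloballyMinimal_of_krausCriterion_bounded₂ 0 0 0 0 (-195112) (by decide +kernel) (by decide +kernel)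
    (by decide +kernel)

/-- `y² = x³ − 195112` has CM (`j = 0 ∈` the thirteen CM values), for any globally minimal `A` with this integral
model. [cite: SilvermanAEC2009, App. C §11] -/
theorem hasCM_cm0m195112 {A : WeierstrassCurve ℚ} [A.IsElliptic] [A.IsGloballyMinimal]
    (hIA : integralModelInt A = ⟨0, 0, 0, 0, -195112⟩) : A.HasCM :=
  (hasCM_iff_j_mem_holds A).mpr (by rw [j_eq_of_intModel 0 0 0 0 (-195112) hIA]; decide +kernel)

/-! ### §3. The records -/

/-- `#{Ẽ(𝔽_3)} = 4` for the Cremona model of `55648b1` (`a_3 = 0`: good SUPERSINGULAR; kernel count).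
[cite: Cremona2006, Table 1 (Cremona label 55648b1)] -/
theorem card_c55648b1_3 :
    Nat.card (((⟨0, 0, 0, -84731, 9493506⟩ : WeierstrassCurve ℤ).map
      (Int.castRingHom (ZMod 3))).toAffine.Point) = 4 := by
  rw [@WeierstrassCurve.natCard_point_eq_one_add_card (ZMod 3) (@ZMod.instField 3 ⟨by norm_num⟩) _ _ _
    (by decide +kernel), @card_sol_eq_sum_euler (ZMod 3) (@ZMod.instField 3 ⟨by norm_num⟩) _ _
    (by rw [ZMod.ringChar_zmod_n]; decide), ZMod.card]
  decide +kernel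

/-- The Cremona model of `55648b1` is an elliptic curve (`Δ ≠ 0`, kernel). [cite: Cremona2006, Table 1 (Cremona label 55648b1)] -/
theorem isElliptic_c55648b1 : (⟨0, 0, 0, -84731, 9493506⟩ : WeierstrassCurve ℚ).IsElliptic :=
  isElliptic_of_discOf_ne_zero 0 0 0 (-84731) 9493506 (by decide +kernel)

/-- The Cremona model of `55648b1` is globally minimal (Kraus' bounded criterion, kernel). [cite: SilvermanAEC2009, VII.1 Remark 1.1] -/
theorem isGloballyMinimal_c55648b1 : (⟨0, 0, 0, -84731, 9493506⟩ : WeierstrassCurve ℚ).IsGloballyMinimal :=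
  isGloballyMinimal_of_krausCriterion_bounded₂ 0 0 0 (-84731) 9493506 (by decide +kernel) (by decide +kernel)
    (by decide +kernel)

/-- **Kobayashi's ± main conjecture, BOTH signs, for `55648b1 @ 3`** (Cremona model `[0,0,0,−84731,9493506]`,
`N = 55648 = 2⁵·37·47`, analytic rank `0`; non-surjective mod-`3` image `3Nn` = normaliser of the non-split Cartan;
the ONE rank-`0` X7 class at `p = 3` with `a_3 = 0` that TARGET §6.0b lists as «theorem needed» — an item-4 pair)
**by CM-congruence transfer from `E' = 32a2 : y² = x³ − x`, MODULO the OPEN binder `hCL` (Corpuz–Lei 2025, PRE)**.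
The congruence `E[3] ≃ E'[3]` is a THEOREM of the kernel with NO named fact: `E` is `ℚ`-isomorphic to the member
`(λ:μ) = (44:9)` of the dual Hesse pencil `X⁻_{E'}(3)` (Fisher 2012 §13, PROVED in the tree:
`threeCongruent_of_dualHesseCertificate_unconditional`), the two covariant identities with `u = 1/108` checked by
`norm_num`. Published inputs BY NAME: Pollack–Rubin (`hPR`), period units (`h5`, `h3`). Displayed certificate:
`hL'` — `L(E',1)/Ω(E') = 1/8` (engines: PARI `ellL1`/`omega` kit j250436; PARI-free modular symbols `[0]⁺ = 1/8`,
kit j250942), a `3`-adic unit (kernel). Kernel-decided: both models elliptic and minimal, `3 ∤ Δ` on both,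
`#Ẽ(𝔽_3) = #Ẽ'(𝔽_3) = 4` (`a_3 = 0`), `j(E') = 1728` (CM). Per pair; item 4 stays OPEN; nothing booked.
[claim: CorpuzLei2025, status: under-review] [cite: PollackRubin2004, Theorem (p. 448) = Thm. 7.3]
[cite: Fisher2012Hessian, §13 (analogue of Thm. 13.2 for X_E^-(3))] [cite: Cremona2006, Table 1 (Cremona labels 55648b1, 32a2)] -/
theorem kobayashiMainConjecture_c55648b1_3_of_transfer_OPEN
    (hCL : CorpuzLei2025_signedMainConjecture_transfer_OPEN)
    (hPR : PollackRubin2004.mainTheorem_signedCharIdeal_eq_of_cm)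
    (h5 : realPeriodRat_eq_unit_mul_plusPeriod) (h3 : realPeriodRat_eq_unit_mul_plusPeriod_three)
    (W A : WeierstrassCurve ℚ) [W.IsElliptic] [W.IsGloballyMinimal] [A.IsElliptic] [A.IsGloballyMinimal]
    [Fact (Nat.Prime 3)] (hW : W = ⟨0, 0, 0, -84731, 9493506⟩) (hA : A = ⟨0, 0, 0, -1, 0⟩)
    (hL' : A.entireLFunction 1 / (A.realPeriodRat : ℂ) = ((1 / 8 : ℚ) : ℂ)) (ε : ℤˣ) :
    KobayashiMainConjecture W 3 ε := by
  have hIW : integralModelInt W = ⟨0, 0, 0, -84731, 9493506⟩ :=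
    integralModelInt_eq_of_map_eq _ (by rw [hW]; ext <;> simp [WeierstrassCurve.map])
  have hIA : integralModelInt A = ⟨0, 0, 0, -1, 0⟩ :=
    integralModelInt_eq_of_map_eq _ (by rw [hA]; ext <;> simp [WeierstrassCurve.map])
  have hΔ : (⟨0, 0, 0, -84731, 9493506⟩ : WeierstrassCurve ℤ).Δ = discOf [0, 0, 0, -84731, 9493506] :=
    intCurve_Δ 0 0 0 (-84731) 9493506
  have hΔA : (⟨0, 0, 0, -1, 0⟩ : WeierstrassCurve ℤ).Δ = discOf [0, 0, 0, -1, 0] := intCurve_Δ 0 0 0 (-1) 0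
  have hgood : W.HasGoodReductionAtPrime 3 :=
    hasGoodReductionAtPrime_of_not_dvd W 3 (by rw [minimalDiscriminantInt_eq hIW, hΔ]; decide +kernel)
  have hgoodA : A.HasGoodReductionAtPrime 3 :=
    hasGoodReductionAtPrime_of_not_dvd A 3 (by rw [minimalDiscriminantInt_eq hIA, hΔA]; decide +kernel)
  have hap : W.frobeniusTrace 3 = 0 := by rw [frobeniusTrace_eq hIW card_c55648b1_3]; norm_num
  have hapA : A.frobeniusTrace 3 = 0 := by rw [frobeniusTrace_eq hIA card_cm32a2_3]; norm_num
  have hc4 : W.c₄ = (4067088 : ℚ) := by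
    subst hW; norm_num [WeierstrassCurve.c₄, WeierstrassCurve.b₂, WeierstrassCurve.b₄]
  have hc6 : W.c₆ = (-8202389184 : ℚ) := by
    subst hW; norm_num [WeierstrassCurve.c₆, WeierstrassCurve.b₂, WeierstrassCurve.b₄, WeierstrassCurve.b₆]
  have hc4A : A.c₄ = (48 : ℚ) := by
    subst hA; norm_num [WeierstrassCurve.c₄, WeierstrassCurve.b₂, WeierstrassCurve.b₄]
  have hc6A : A.c₆ = (0 : ℚ) := by
    subst hA; norm_num [WeierstrassCurve.c₆, WeierstrassCurve.b₂, WeierstrassCurve.b₄, WeierstrassCurve.b₆]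
  -- C1 as a THEOREM: `E` is the member `(44 : 9)` of the dual Hesse pencil of `E'`, scaling `u = 1/108`
  have hiso := threeCongruent_of_dualHesseCertificate_unconditional A W ((44 : ℚ) / 9) 1 ((1 : ℚ) / 108)
    (by norm_num) (by rw [hc4A, hc6A, hc4, eval_hesseD3]; norm_num)
    (by rw [hc4A, hc6A, hc6, eval_hesseC6three]; norm_num)
  exact kobayashiMainConjecture_of_cmPartner_of_lvalue_of_transfer_OPEN W A 3 hCL hPR h5 h3 (by norm_num)
    hgood hap (hasCM_cm32a2 hIA) hgoodA hapA hiso (by norm_num) hL'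
    (by rw [show ((1 : ℚ) / 8) = ((1 : ℕ) : ℚ) / (8 : ℕ) by norm_num]
        exact padicValRat_natCast_div_natCast_eq_zero 3 1 8 (by norm_num) (by norm_num)) ε

/-- **Item 4's conclusion at the pair `(55648b1, 3)`** in the crux's literal shape `∃ ε, KobayashiMainConjecture W 3 ε`,
MODULO the OPEN binder (from `kobayashiMainConjecture_c55648b1_3_of_transfer_OPEN`, which gives both signs).
[claim: CorpuzLei2025, status: under-review] [cite: Kobayashi2003, Conjecture (Main Conjecture) (p. 2)] -/
theorem exists_kobayashiMainConjecture_c55648b1_3_of_transfer_OPEN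
    (hCL : CorpuzLei2025_signedMainConjecture_transfer_OPEN)
    (hPR : PollackRubin2004.mainTheorem_signedCharIdeal_eq_of_cm)
    (h5 : realPeriodRat_eq_unit_mul_plusPeriod) (h3 : realPeriodRat_eq_unit_mul_plusPeriod_three)
    (W A : WeierstrassCurve ℚ) [W.IsElliptic] [W.IsGloballyMinimal] [A.IsElliptic] [A.IsGloballyMinimal]
    [Fact (Nat.Prime 3)] (hW : W = ⟨0, 0, 0, -84731, 9493506⟩) (hA : A = ⟨0, 0, 0, -1, 0⟩)
    (hL' : A.entireLFunction 1 / (A.realPeriodRat : ℂ) = ((1 / 8 : ℚ) : ℂ)) :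
    ∃ ε : ℤˣ, KobayashiMainConjecture W 3 ε :=
  ⟨1, kobayashiMainConjecture_c55648b1_3_of_transfer_OPEN hCL hPR h5 h3 W A hW hA hL' 1⟩

/-- `#{Ẽ(𝔽_5)} = 6` for the Cremona model of `484416do1` (`a_5 = 0`: good SUPERSINGULAR; kernel count).
[cite: Cremona2006, Table 1 (Cremona label 484416do1)] -/
theorem card_c484416do1_5 :
    Nat.card (((⟨0, 0, 0, -10445220, 27167199768⟩ : WeierstrassCurve ℤ).map
      (Int.castRingHom (ZMod 5))).toAffine.Point) = 6 := by
  rw [@WeierstrassCurve.natCard_point_eq_one_add_card (ZMod 5) (@ZMod.instField 5 ⟨by norm_num⟩) _ _ _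
    (by decide +kernel), @card_sol_eq_sum_euler (ZMod 5) (@ZMod.instField 5 ⟨by norm_num⟩) _ _
    (by rw [ZMod.ringChar_zmod_n]; decide), ZMod.card]
  decide +kernel

/-- The Cremona model of `484416do1` is an elliptic curve (`Δ ≠ 0`, kernel). [cite: Cremona2006, Table 1 (Cremona label 484416do1)] -/
theorem isElliptic_c484416do1 : (⟨0, 0, 0, -10445220, 27167199768⟩ : WeierstrassCurve ℚ).IsElliptic :=
  isElliptic_of_discOf_ne_zero 0 0 0 (-10445220) 27167199768 (by decide +kernel)

/-- The Cremona model of `484416do1` is globally minimal (Kraus' bounded criterion, kernel). [cite: SilvermanAEC2009, VII.1 Remark 1.1] -/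
theorem isGloballyMinimal_c484416do1 :
    (⟨0, 0, 0, -10445220, 27167199768⟩ : WeierstrassCurve ℚ).IsGloballyMinimal :=
  isGloballyMinimal_of_krausCriterion_bounded₂ 0 0 0 (-10445220) 27167199768 (by decide +kernel)
    (by decide +kernel) (by decide +kernel)

/-- **Kobayashi's ± main conjecture, BOTH signs, for `484416do1 @ 5`** (Cremona model `[0,0,0,−10445220,27167199768]`,
`N = 484416 = 2⁶·3²·29²`, analytic rank `0`; non-surjective mod-`5` image `5Nn`; an item-4 pair of the unit zone)
**by CM-congruence transfer from `E' = [0,0,0,0,−195112] : y² = x³ − 2³·29³` (`j = 0`, conductor `484416`), MODULO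
the OPEN binder `hCL` (Corpuz–Lei 2025, PRE) and Fisher 2012 Thm. 13.2 (`hF`, named fact)**: `E` is `ℚ`-isomorphic
to the member `(λ:μ) = (696:1)` of the Hesse pencil `X_{E'}(5)` (`fiveCongruent_of_hesseCertificate`, the two
covariant identities with `u = 1469903105654784` checked by `norm_num` on the tree's closed forms). Published inputs
BY NAME: `hPR`, `h5`, `h3`, `hF`. Displayed certificate `hL'`: `L(E',1)/Ω(E') = 2` (two engines, kit j250436 /
j250942), a `5`-adic unit. Kernel-decided: ellipticity, minimality, `5 ∤ Δ` both, `#Ẽ(𝔽_5) = #Ẽ'(𝔽_5) = 6`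
(`a_5 = 0`), `j(E') = 0` (CM). Per pair; item 4 stays OPEN; nothing booked.
[claim: CorpuzLei2025, status: under-review] [cite: PollackRubin2004, Theorem (p. 448) = Thm. 7.3]
[cite: Fisher2012Hessian, Thm. 13.2 (n = 5)] [cite: Cremona2006, Table 1 (Cremona label 484416do1)] -/
theorem kobayashiMainConjecture_c484416do1_5_of_transfer_OPEN
    (hCL : CorpuzLei2025_signedMainConjecture_transfer_OPEN)
    (hPR : PollackRubin2004.mainTheorem_signedCharIdeal_eq_of_cm)
    (h5 : realPeriodRat_eq_unit_mul_plusPeriod) (h3 : realPeriodRat_eq_unit_mul_plusPeriod_three)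
    (hF : thm132_fiveCongruent_hessePencil)
    (W A : WeierstrassCurve ℚ) [W.IsElliptic] [W.IsGloballyMinimal] [A.IsElliptic] [A.IsGloballyMinimal]
    [Fact (Nat.Prime 5)] (hW : W = ⟨0, 0, 0, -10445220, 27167199768⟩) (hA : A = ⟨0, 0, 0, 0, -195112⟩)
    (hL' : A.entireLFunction 1 / (A.realPeriodRat : ℂ) = ((2 : ℚ) : ℂ)) (ε : ℤˣ) :
    KobayashiMainConjecture W 5 ε := by
  have hIW : integralModelInt W = ⟨0, 0, 0, -10445220, 27167199768⟩ :=
    integralModelInt_eq_of_map_eq _ (by rw [hW]; ext <;> simp [WeierstrassCurve.map])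
  have hIA : integralModelInt A = ⟨0, 0, 0, 0, -195112⟩ :=
    integralModelInt_eq_of_map_eq _ (by rw [hA]; ext <;> simp [WeierstrassCurve.map])
  have hΔ : (⟨0, 0, 0, -10445220, 27167199768⟩ : WeierstrassCurve ℤ).Δ =
      discOf [0, 0, 0, -10445220, 27167199768] := intCurve_Δ 0 0 0 (-10445220) 27167199768
  have hΔA : (⟨0, 0, 0, 0, -195112⟩ : WeierstrassCurve ℤ).Δ = discOf [0, 0, 0, 0, -195112] :=
    intCurve_Δ 0 0 0 0 (-195112)
  have hgood : W.HasGoodReductionAtPrime 5 :=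
    hasGoodReductionAtPrime_of_not_dvd W 5 (by rw [minimalDiscriminantInt_eq hIW, hΔ]; decide +kernel)
  have hgoodA : A.HasGoodReductionAtPrime 5 :=
    hasGoodReductionAtPrime_of_not_dvd A 5 (by rw [minimalDiscriminantInt_eq hIA, hΔA]; decide +kernel)
  have hap : W.frobeniusTrace 5 = 0 := by rw [frobeniusTrace_eq hIW card_c484416do1_5]; norm_num
  have hapA : A.frobeniusTrace 5 = 0 := by rw [frobeniusTrace_eq hIA card_cm0m195112_5]; norm_num
  have hc4 : W.c₄ = (501370560 : ℚ) := by
    subst hW; norm_num [WeierstrassCurve.c₄, WeierstrassCurve.b₂, WeierstrassCurve.b₄]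
  have hc6 : W.c₆ = (-23472460599552 : ℚ) := by
    subst hW; norm_num [WeierstrassCurve.c₆, WeierstrassCurve.b₂, WeierstrassCurve.b₄, WeierstrassCurve.b₆]
  have hc4A : A.c₄ = (0 : ℚ) := by
    subst hA; norm_num [WeierstrassCurve.c₄, WeierstrassCurve.b₂, WeierstrassCurve.b₄]
  have hc6A : A.c₆ = (168576768 : ℚ) := by
    subst hA; norm_num [WeierstrassCurve.c₆, WeierstrassCurve.b₂, WeierstrassCurve.b₄, WeierstrassCurve.b₆]
  -- C1: `E` is the member `(696 : 1)` of the Hesse pencil `X_{E'}(5)`, scaling `u = 1469903105654784`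
  have hiso := fiveCongruent_of_hesseCertificate hF A W (696 : ℚ) 1 ((1469903105654784 : ℚ))
    (by norm_num) (by rw [hc4A, hc6A, hc4, eval_hesseC4]; norm_num)
    (by rw [hc4A, hc6A, hc6, eval_hesseC6]; norm_num)
  exact kobayashiMainConjecture_of_cmPartner_of_lvalue_of_transfer_OPEN W A 5 hCL hPR h5 h3 (by norm_num)
    hgood hap (hasCM_cm0m195112 hIA) hgoodA hapA hiso (by norm_num) hL'
    (by rw [show (2 : ℚ) = ((2 : ℕ) : ℚ) / (1 : ℕ) by norm_num]
        exact padicValRat_natCast_div_natCast_eq_zero 5 2 1 (by norm_num) (by norm_num)) ε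

/-- **Item 4's conclusion at the pair `(484416do1, 5)`** in the crux's literal shape, MODULO the OPEN binder and
Fisher's Thm. 13.2. [claim: CorpuzLei2025, status: under-review] [cite: Kobayashi2003, Conjecture (Main Conjecture) (p. 2)] -/
theorem exists_kobayashiMainConjecture_c484416do1_5_of_transfer_OPEN
    (hCL : CorpuzLei2025_signedMainConjecture_transfer_OPEN)
    (hPR : PollackRubin2004.mainTheorem_signedCharIdeal_eq_of_cm)
    (h5 : realPeriodRat_eq_unit_mul_plusPeriod) (h3 : realPeriodRat_eq_unit_mul_plusPeriod_three)
    (hF : thm132_fiveCongruent_hessePencil)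
    (W A : WeierstrassCurve ℚ) [W.IsElliptic] [W.IsGloballyMinimal] [A.IsElliptic] [A.IsGloballyMinimal]
    [Fact (Nat.Prime 5)] (hW : W = ⟨0, 0, 0, -10445220, 27167199768⟩) (hA : A = ⟨0, 0, 0, 0, -195112⟩)
    (hL' : A.entireLFunction 1 / (A.realPeriodRat : ℂ) = ((2 : ℚ) : ℂ)) :
    ∃ ε : ℤˣ, KobayashiMainConjecture W 5 ε :=
  ⟨1, kobayashiMainConjecture_c484416do1_5_of_transfer_OPEN hCL hPR h5 h3 hF W A hW hA hL' 1⟩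

end Summit.BirchSwinnertonDyer.BirchSwinnertonDyer.Theorems

end
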